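import Literature.MathematicalPhysics.QuantumFieldTheory.Balaban1983to89.B9Eq3117CurrentMajFromLetter
import Literature.MathematicalPhysics.QuantumFieldTheory.Balaban1983to89.B9Eq336RegularAtAllBondsP
import Literature.MathematicalPhysics.QuantumFieldTheory.Balaban1983to89.B9CoReadingCoordsTranspose
import Literature.MathematicalPhysics.QuantumFieldTheory.Balaban1983to89.B9Thm312Whole

/-!
# BalabanUVNodes ∕ N06 ([B9], `Dag.B9_main`) — THE CURRENT LETTERS `hBJ` OF THE STAGE-11 CERTIFICATE (`CurrentMaj` at node00-def-Y's models `B = Δ(U)∘D_U`,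
# `B† = D*_U∘Δ(U)`; editions ≥ 23, `…N06AtOpsYNuOfRecordV6EPairNS` :158) AT THE PINS, FROM A NORM-LOCAL FORM OF (3.117) + REGULARITY AT EVERY FINE BOND
# (the W-b road's END); and the STEP-3 face at print's cube class, where the regularity is a THEOREM of (3.36)

Track A of `YM-PLAN.md` (cell `pub-ymgap`, HUMAN RULING D-0062), node **N06** = [Balaban1985BackgroundPropagators] Thms 3.1–3.15; WIDTH-209, seat
`pub-ymgap-dag-n06-w8` (g4), CLAIM-12, 2026-08-28.  A HELPER for the stage-11 certificate of dag-n06-d (binder `hBJ`; consumed through dag-n06-d's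
`…N06SplitMajorantsAtPinsPhys.split_majorants_of_letter_schemas` and this lineage's `…N06StepL2AtPinsPhys(R∕P).stepL2_of_letter_schemas(_residual)`).
WHAT.  The certificate DISPLAYS `hBJ : ∀ x, M₁₂ ≤ M_x → ∀ α₀ > 0, M_xα₀ ≤ a₁₂ → ∀ U, Reg335 → Reg336 → CurrentMaj (𝔬12 x).blkW (𝔬12 x).blk (BcoKH … U) (BdcoKH … U) 1
(H x) (t_J·(M_xα₀)) δ_B` — print's (3.117) + (3.36): `B(U) = Δ(U)∘D_U` and `B†` are one-step stencils of size `O(1)Mα₀(Lʲη)⁻³`.  THIS FILE derives that binder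
from three DISPLAYED inputs about def-Y's GENUINE objects and the certificate's pins:
* `h3117g ∕ h3117d` — (3.117) IN NORM-LOCAL FORM (the Literature module `B9Eq3117CurrentMajFromLetter`, clauses `hg ∕ hdh`): in the regime,
  `‖(hessGradY U λ)(f)‖ ≤ k₃·‖JY U f‖·(‖λ(f₋)‖ + ‖λ(f₊)‖)` and `‖(divHessY U A)(x)‖ ≤ k₃·Σ_μ (‖JY U ⟨x,μ⟩‖·‖A⟨x,μ⟩‖ + ‖JY U ⟨x−e_μ,μ⟩‖·‖A⟨x−e_μ,μ⟩‖)` — the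
  content of p. 419's identity «`(ΔD_Uλ)(b) = (i∕2)[J(b), λ(b₋) + R(U_b)λ(b₊)]`» (node00-def-Y's road; stone 1 = `Node00/OpsYCurlGrad`), `k₃` displayed;
* `hreg` — REGULARITY AT EVERY FINE BOND (VERBATIM this lineage's F8 ∕ F10 binder): r06's `RegularAt (shiftsV1 …) U η (c_J·M_xα₀) (len (bI x ⟨s, 0⟩)) μ s`
  ((3.35)–(3.36) at the scale of the block the bond's source is pinned to; at print's cube class a THEOREM — F12 `B9Eq336RegularAtAllBondsP` §6);
* the pins `hblk12 ∕ hblkW12` (the certificate's block maps `blkBK (bI x)` ∕ `blkSK (sIK (bI x))`, :172), `hbI0` (:78), `hβ1` (:77), and the numerics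
  `c_J·a ≤ 1` (print's `O(1)Mα₀ ≤ 1`), `0 ≤ δ_B`, ONE displayed constant `t_J ≥ 2(d+1)·L³·k₃·(10⁴(d+1)·c_J)·e^{3δ_B}`.
★★ `currentMaj_at_pins` — member-level core (no class premise: the three inputs AT `U`).  ★★ `hBJ_of_letters3117` — the binder `hBJ` VERBATIM (premises
`(bg9Y …).Reg335∕336 c35Y α₀ U`, thresholds `(M, a)` of the displayed inputs).  ★★ `hBJ_of_letters3117_P` — THE STEP-3 (α) FACE (dag-n06-d ∕ def-Y ruling:
objects over `bg9Y`, premises `(bg9YP …).Reg335∕336 c α₀ U`, `c ≤ 10`): `hreg` DISCHARGED by F12 `regularAt_pinScale_of_regYP336` (`c_J := 10·L⁷`,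
`10·L⁷·a ≤ 1`), so `hBJ` follows from `h3117g ∕ h3117d` ALONE.
NET FOR THE KNIT: the schema `hBJ` (two free constants) ↦ the parameter-free print clauses `h3117g ∕ h3117d` (+ `hreg`, already displayed on the (3.137) road
and a theorem at print's class).  KNIT RECIPE: `hBJ := hBJ_of_letters3117 H 𝔬12 bI hbI0 hβ1 hblk12 hblkW12 k₃ cJ tJ δB M a hk₃ hcJ ha1 hδB htJ h3117g h3117d hreg`.
HONEST FRAMING.  Kernel bookkeeping over the Literature module's [4]-(2.51) majorants and r06's (3.36) theorem; COUNT-NEUTRAL; (3.117) stays DISPLAYED (norm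
form) until def-Y's stones land; nothing of [B9] asserted; N06 NOT discharged; K1⁷∕K1⁹ NOT closed; no summit statement is proved — one finite 𝕋⁴ programme at
fixed `ε`: NOT continuum, NOT OS, NOT the mass gap ∕ Clay.  0 `def`, 0 `sorry`.
-/

noncomputable section

namespace Summit.QuantumFields.YangMills.BalabanUVNodes.N06CurrentMajAtPinsPhys

open Literature.MathematicalPhysics.QuantumFieldTheory.Balaban1983to89
open Literature.MathematicalPhysics.QuantumFieldTheory.Balaban1983to89.Node00 (CfgY SiteY FBondY IBondY JY Stage3Params etaBY)
open Literature.MathematicalPhysics.QuantumFieldTheory.Balaban1983to89.B9Thm34Ext (toB6)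
open Literature.MathematicalPhysics.QuantumFieldTheory.Balaban1983to89.B9PerturbationMajorantAlgebra (CurrentMaj)
open Literature.MathematicalPhysics.QuantumFieldTheory.Balaban1983to89.B9PerturbationMajorantsAtLetters (BcoKH BdcoKH)
open Literature.MathematicalPhysics.QuantumFieldTheory.Balaban1983to89.B9PerturbationSplitAtLetters (hessGradY divHessY)
open Literature.MathematicalPhysics.QuantumFieldTheory.Balaban1983to89.B9PinMembersKLevelV1 (MemberY geo9Y bg9Y)
open Literature.MathematicalPhysics.QuantumFieldTheory.Balaban1983to89.B9BackgroundsKLevelV1P (bg9YP)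
open Literature.MathematicalPhysics.QuantumFieldTheory.Balaban1983to89.B9PinGeometryKLevelV1 (c35Y)
open Literature.MathematicalPhysics.QuantumFieldTheory.Balaban1983to89.B9GeoLemma21KLevelV1 (geo9K_one_le_L geo9K_eta_pos geo9K_M_nonneg)
open Literature.MathematicalPhysics.QuantumFieldTheory.Balaban1983to89.B7Prop2SpecialUnitary (specialUnitaryUnits)
open Literature.MathematicalPhysics.QuantumFieldTheory.Balaban1983to89.B9CoReadingCoords (XBK blkBK)
open Literature.MathematicalPhysics.QuantumFieldTheory.Balaban1983to89.B9CoReadingCoordsH (XHK)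
open Literature.MathematicalPhysics.QuantumFieldTheory.Balaban1983to89.B9CoReadingCoordsS (XSK blkSK sIK)
open Literature.MathematicalPhysics.QuantumFieldTheory.Balaban1983to89.B9CoReadingCoordsTranspose (TrIdx trBasis)
open Literature.MathematicalPhysics.QuantumFieldTheory.Balaban1983to89.B9Eq336CurrentBound (RegularAt)
open Literature.MathematicalPhysics.QuantumFieldTheory.Balaban1983to89.B9BackgroundsKLevelV1 (shiftsV1)
open Literature.MathematicalPhysics.QuantumFieldTheory.Balaban1983to89.B6GlobalChartV1 (PV blkV1 boxEquiv)
open Literature.MathematicalPhysics.QuantumFieldTheory.Balaban1983to89.B6Ineq2142KLevelV1 (β)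
open Literature.MathematicalPhysics.QuantumFieldTheory.Balaban1983to89.B6Geom246MultiLevelTorus (geomT)
open Literature.MathematicalPhysics.QuantumFieldTheory.Balaban1983to89.B6KLevelCensusIndexV1 (kGeo)
open Literature.MathematicalPhysics.QuantumFieldTheory.Balaban1983to89.B9Delta2FormMajorant (norm_JY_le_of_regularAt)
open Literature.MathematicalPhysics.QuantumFieldTheory.Balaban1983to89.B9Eq336RegularAtAllBondsP (regularAt_pinScale_of_regYP336)
open Literature.MathematicalPhysics.QuantumFieldTheory.Balaban1983to89.B9Eq3117CurrentMajFromLetter (currentMaj_of_letter)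
open scoped Matrix.Norms.L2Operator

variable {N : ℕ} {θ : Stage3Params} {Mstar : ℕ}
variable [∀ x : MemberY θ.d₆ θ.ℓ₆ θ.hd' θ.hL' θ.b₀ θ.b₁ Mstar, Fintype (geo9Y x).Site]

/-- ★★ **THE CURRENT LETTERS AT ONE MEMBER, ONE CONFIGURATION — THE CORE** (no class premise): at `x : MemberY`, a pinned operator record `𝔬x` whose block maps
are the certificate's (`blkBK bIx`, `blkSK (sIK bIx)`), and a configuration `U`, the two norm-local (3.117) clauses AT `U` (`hg ∕ hdh`, constant `k₃`) and r06's
`RegularAt` at every fine bond at the pinned scale (constant `c_J·(M_xα₀) ≤ 1`) give dag-n06-l's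
`CurrentMaj 𝔬x.blkW 𝔬x.blk (BcoKH x.toKIdx (trBasis N) (bg9Y …) id U) (BdcoKH …) 1 (H x) (t_J·(M_xα₀)) δ_B` for every `δ_B ≥ 0` and
`t_J ≥ 2(d+1)·L³·k₃·(10⁴(d+1)·c_J)·e^{3δ_B}` (F5 `norm_JY_le_of_regularAt` feeds the Literature module's `currentMaj_of_letter`).
[cite: Balaban1985BackgroundPropagators, (3.117) p.419, (3.36) p.396, p.422; Balaban1984PropagatorsII, (2.51) p.232] -/
theorem currentMaj_at_pins (H : MemberY θ.d₆ θ.ℓ₆ θ.hd' θ.hL' θ.b₀ θ.b₁ Mstar → Prop) (x : MemberY θ.d₆ θ.ℓ₆ θ.hd' θ.hL' θ.b₀ θ.b₁ Mstar)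
    (𝔬x : B9Thm312Whole.Ops (geo9Y x) (bg9Y (Matrix (Fin N) (Fin N) ℂ) (specialUnitaryUnits (Fin N)) x)
      (XBK (TrIdx N) x.toKIdx) (XBK (TrIdx N) x.toKIdx) (XHK (TrIdx N) x.toKIdx) (XSK (TrIdx N) x.toKIdx))
    (bIx : FBondY x.toKIdx → IBondY x.toKIdx) (hbI0 : ∀ f : FBondY x.toKIdx, bIx f = bIx ⟨f.src, 0⟩)
    (hβ1 : ∀ f : FBondY x.toKIdx, (geomT x.D).dist (β x.hN x.D x.hk (bIx f)) (blkV1 x.hN x.D f) ≤ 1)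
    (hblk : 𝔬x.blk = blkBK x.toKIdx bIx) (hblkW : 𝔬x.blkW = blkSK x.toKIdx (sIK x.toKIdx bIx))
    {k₃ cJ tJ δB α₀ : ℝ} (hk₃ : 0 ≤ k₃) (hcJ : 0 ≤ cJ) (hα : 0 < α₀) (hC1 : cJ * ((geo9Y x).M * α₀) ≤ 1) (hδB : 0 ≤ δB)
    (htJ : 2 * ((θ.d₆ : ℝ) + 1) * (((θ.ℓ₆ + 1 : ℕ) : ℝ)) ^ 3 * k₃ * (10 ^ 4 * ((θ.d₆ : ℝ) + 1) * cJ) * Real.exp (3 * δB) ≤ tJ)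
    (U : (bg9Y (Matrix (Fin N) (Fin N) ℂ) (specialUnitaryUnits (Fin N)) x).Cfg)
    (hg : ∀ (Λ : SiteY x.toKIdx → Matrix (Fin N) (Fin N) ℂ) (f : FBondY x.toKIdx),
      ‖hessGradY x.toKIdx U Λ f‖ ≤ k₃ * ‖JY x.toKIdx U f‖ * (‖Λ (boxEquiv x.hN f.src)‖ + ‖Λ (boxEquiv x.hN f.tgt)‖))
    (hdh : ∀ (A : FBondY x.toKIdx → Matrix (Fin N) (Fin N) ℂ) (s : Site (PV θ.d₆ θ.ℓ₆ x.toKIdx.m x.toKIdx.K θ.hd' θ.hL') 0),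
      ‖divHessY x.toKIdx U A (boxEquiv x.hN s)‖ ≤ k₃ * ∑ μ : Fin (θ.d₆ + 1),
        (‖JY x.toKIdx U ⟨s, μ⟩‖ * ‖A ⟨s, μ⟩‖ + ‖JY x.toKIdx U ⟨s.unshift μ, μ⟩‖ * ‖A ⟨s.unshift μ, μ⟩‖))
    (hregU : ∀ μ s, RegularAt (shiftsV1 (PV θ.d₆ θ.ℓ₆ x.toKIdx.m x.toKIdx.K θ.hd' θ.hL')) U (etaBY x.toKIdx)
      (cJ * ((geo9Y x).M * α₀)) ((geo9Y x).len (bIx ⟨s, 0⟩)) μ s) :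
    CurrentMaj 𝔬x.blkW 𝔬x.blk (BcoKH x.toKIdx (trBasis N) (bg9Y (Matrix (Fin N) (Fin N) ℂ) (specialUnitaryUnits (Fin N)) x) (fun U => U) U)
      (BdcoKH x.toKIdx (trBasis N) (bg9Y (Matrix (Fin N) (Fin N) ℂ) (specialUnitaryUnits (Fin N)) x) (fun U => U) U) 1 (H x)
      (tJ * ((geo9Y x).M * α₀)) δB := by
  have hMα : 0 ≤ (geo9Y x).M * α₀ := mul_nonneg (geo9K_M_nonneg x.toKIdx) hα.le
  have hC0 : 0 ≤ cJ * ((geo9Y x).M * α₀) := mul_nonneg hcJ hMα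
  -- η ≤ L^j η at every block
  have hlen : ∀ y : (geo9Y x).Site, etaBY x.toKIdx ≤ (geo9Y x).len y := fun y => by
    show (geo9Y x).eta ≤ (geo9Y x).L ^ (geo9Y x).scale y * (geo9Y x).eta
    exact le_mul_of_one_le_left (geo9K_eta_pos x.toKIdx).le (one_le_pow₀ (geo9K_one_le_L x.toKIdx))
  -- the per-bond current size from r06's (3.36) theorem
  have hJ : ∀ f : FBondY x.toKIdx, ‖JY x.toKIdx U f‖ ≤ 10 ^ 4 * ((θ.d₆ : ℝ) + 1) * (cJ * ((geo9Y x).M * α₀)) * ((geo9Y x).len (bIx f) ^ 3)⁻¹ := by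
    intro f
    have h := norm_JY_le_of_regularAt x.toKIdx (fun s => bIx ⟨s, 0⟩) (geo9Y x).len (fun y => hlen y) hC0 hC1 U hregU f
    rw [← hbI0 f] at h
    exact_mod_cast h
  have hCJ : 0 ≤ 10 ^ 4 * ((θ.d₆ : ℝ) + 1) * (cJ * ((geo9Y x).M * α₀)) := by positivity
  have htB : 2 * ((θ.d₆ : ℝ) + 1) * (geo9Y x).L ^ 3 * k₃ * (10 ^ 4 * ((θ.d₆ : ℝ) + 1) * (cJ * ((geo9Y x).M * α₀))) * Real.exp (3 * δB) ≤
      tJ * ((geo9Y x).M * α₀) := by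
    have hL : (geo9Y x).L = (((θ.ℓ₆ + 1 : ℕ) : ℝ)) := rfl
    have e : 2 * ((θ.d₆ : ℝ) + 1) * (geo9Y x).L ^ 3 * k₃ * (10 ^ 4 * ((θ.d₆ : ℝ) + 1) * (cJ * ((geo9Y x).M * α₀))) * Real.exp (3 * δB) =
        (2 * ((θ.d₆ : ℝ) + 1) * (((θ.ℓ₆ + 1 : ℕ) : ℝ)) ^ 3 * k₃ * (10 ^ 4 * ((θ.d₆ : ℝ) + 1) * cJ) * Real.exp (3 * δB)) * ((geo9Y x).M * α₀) := by
      rw [hL]; ring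
    rw [e]
    exact mul_le_mul_of_nonneg_right htJ hMα
  rw [hblk, hblkW]
  letI : Fintype (B9GeoNormsKLevelV1.geo9K x.toKIdx).Site := (inferInstance : Fintype (geo9Y x).Site)
  exact currentMaj_of_letter x.toKIdx (trBasis N) (bg9Y (Matrix (Fin N) (Fin N) ℂ) (specialUnitaryUnits (Fin N)) x) (fun U => U)
    hβ1 hbI0 hk₃ hg hdh hCJ hJ hδB htB 1 (H x)

/-- ★★ **THE CERTIFICATE's BINDER `hBJ` AT THE PINS, VERBATIM, FROM THE DISPLAYED (3.117) CLAUSES + REGULARITY AT EVERY FINE BOND + THE PINS** (module docstring):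
with the thresholds `(M, a)` of the displayed inputs, `∀ x, M ≤ M_x → ∀ α₀ > 0, M_xα₀ ≤ a → ∀ U, Reg335 → Reg336 → CurrentMaj (𝔬12 x).blkW (𝔬12 x).blk (BcoKH … U)
(BdcoKH … U) 1 (H x) (t_J·(M_xα₀)) δ_B`. [cite: Balaban1985BackgroundPropagators, (3.117) p.419, (3.36) p.396, p.422; Balaban1984PropagatorsII, (2.51) p.232] -/
theorem hBJ_of_letters3117 (H : MemberY θ.d₆ θ.ℓ₆ θ.hd' θ.hL' θ.b₀ θ.b₁ Mstar → Prop)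
    (𝔬12 : ∀ x : MemberY θ.d₆ θ.ℓ₆ θ.hd' θ.hL' θ.b₀ θ.b₁ Mstar, B9Thm312Whole.Ops (geo9Y x) (bg9Y (Matrix (Fin N) (Fin N) ℂ) (specialUnitaryUnits (Fin N)) x)
      (XBK (TrIdx N) x.toKIdx) (XBK (TrIdx N) x.toKIdx) (XHK (TrIdx N) x.toKIdx) (XSK (TrIdx N) x.toKIdx))
    (bI : ∀ x : MemberY θ.d₆ θ.ℓ₆ θ.hd' θ.hL' θ.b₀ θ.b₁ Mstar, FBondY x.toKIdx → IBondY x.toKIdx)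
    (hbI0 : ∀ (x : MemberY θ.d₆ θ.ℓ₆ θ.hd' θ.hL' θ.b₀ θ.b₁ Mstar) (f : FBondY x.toKIdx), bI x f = bI x ⟨f.src, 0⟩)
    (hβ1 : ∀ (x : MemberY θ.d₆ θ.ℓ₆ θ.hd' θ.hL' θ.b₀ θ.b₁ Mstar) (f : FBondY x.toKIdx), (geomT x.D).dist (β x.hN x.D x.hk (bI x f)) (blkV1 x.hN x.D f) ≤ 1)
    (hblk12 : ∀ x : MemberY θ.d₆ θ.ℓ₆ θ.hd' θ.hL' θ.b₀ θ.b₁ Mstar, (𝔬12 x).blk = blkBK x.toKIdx (bI x))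
    (hblkW12 : ∀ x : MemberY θ.d₆ θ.ℓ₆ θ.hd' θ.hL' θ.b₀ θ.b₁ Mstar, (𝔬12 x).blkW = blkSK x.toKIdx (sIK x.toKIdx (bI x)))
    (k₃ cJ tJ δB M a : ℝ) (hk₃ : 0 ≤ k₃) (hcJ : 0 ≤ cJ) (ha1 : cJ * a ≤ 1) (hδB : 0 ≤ δB)
    (htJ : 2 * ((θ.d₆ : ℝ) + 1) * (((θ.ℓ₆ + 1 : ℕ) : ℝ)) ^ 3 * k₃ * (10 ^ 4 * ((θ.d₆ : ℝ) + 1) * cJ) * Real.exp (3 * δB) ≤ tJ)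
    (h3117g : ∀ x : MemberY θ.d₆ θ.ℓ₆ θ.hd' θ.hL' θ.b₀ θ.b₁ Mstar, M ≤ (geo9Y x).M → ∀ α₀ : ℝ, 0 < α₀ → (geo9Y x).M * α₀ ≤ a →
      ∀ U : (bg9Y (Matrix (Fin N) (Fin N) ℂ) (specialUnitaryUnits (Fin N)) x).Cfg,
        (bg9Y (Matrix (Fin N) (Fin N) ℂ) (specialUnitaryUnits (Fin N)) x).Reg335 c35Y α₀ U →
        (bg9Y (Matrix (Fin N) (Fin N) ℂ) (specialUnitaryUnits (Fin N)) x).Reg336 c35Y α₀ U →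
          ∀ (Λ : SiteY x.toKIdx → Matrix (Fin N) (Fin N) ℂ) (f : FBondY x.toKIdx),
            ‖hessGradY x.toKIdx U Λ f‖ ≤ k₃ * ‖JY x.toKIdx U f‖ * (‖Λ (boxEquiv x.hN f.src)‖ + ‖Λ (boxEquiv x.hN f.tgt)‖))
    (h3117d : ∀ x : MemberY θ.d₆ θ.ℓ₆ θ.hd' θ.hL' θ.b₀ θ.b₁ Mstar, M ≤ (geo9Y x).M → ∀ α₀ : ℝ, 0 < α₀ → (geo9Y x).M * α₀ ≤ a →
      ∀ U : (bg9Y (Matrix (Fin N) (Fin N) ℂ) (specialUnitaryUnits (Fin N)) x).Cfg,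
        (bg9Y (Matrix (Fin N) (Fin N) ℂ) (specialUnitaryUnits (Fin N)) x).Reg335 c35Y α₀ U →
        (bg9Y (Matrix (Fin N) (Fin N) ℂ) (specialUnitaryUnits (Fin N)) x).Reg336 c35Y α₀ U →
          ∀ (A : FBondY x.toKIdx → Matrix (Fin N) (Fin N) ℂ) (s : Site (PV θ.d₆ θ.ℓ₆ x.toKIdx.m x.toKIdx.K θ.hd' θ.hL') 0),
            ‖divHessY x.toKIdx U A (boxEquiv x.hN s)‖ ≤ k₃ * ∑ μ : Fin (θ.d₆ + 1),
              (‖JY x.toKIdx U ⟨s, μ⟩‖ * ‖A ⟨s, μ⟩‖ + ‖JY x.toKIdx U ⟨s.unshift μ, μ⟩‖ * ‖A ⟨s.unshift μ, μ⟩‖))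
    (hreg : ∀ x : MemberY θ.d₆ θ.ℓ₆ θ.hd' θ.hL' θ.b₀ θ.b₁ Mstar, M ≤ (geo9Y x).M → ∀ α₀ : ℝ, 0 < α₀ → (geo9Y x).M * α₀ ≤ a →
      ∀ U : (bg9Y (Matrix (Fin N) (Fin N) ℂ) (specialUnitaryUnits (Fin N)) x).Cfg,
        (bg9Y (Matrix (Fin N) (Fin N) ℂ) (specialUnitaryUnits (Fin N)) x).Reg335 c35Y α₀ U →
        (bg9Y (Matrix (Fin N) (Fin N) ℂ) (specialUnitaryUnits (Fin N)) x).Reg336 c35Y α₀ U →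
          ∀ μ s, RegularAt (shiftsV1 (PV θ.d₆ θ.ℓ₆ x.toKIdx.m x.toKIdx.K θ.hd' θ.hL')) U (etaBY x.toKIdx)
            (cJ * ((geo9Y x).M * α₀)) ((geo9Y x).len (bI x ⟨s, 0⟩)) μ s) :
    ∀ x : MemberY θ.d₆ θ.ℓ₆ θ.hd' θ.hL' θ.b₀ θ.b₁ Mstar, M ≤ (geo9Y x).M → ∀ α₀ : ℝ, 0 < α₀ → (geo9Y x).M * α₀ ≤ a →
      ∀ U : (bg9Y (Matrix (Fin N) (Fin N) ℂ) (specialUnitaryUnits (Fin N)) x).Cfg,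
        (bg9Y (Matrix (Fin N) (Fin N) ℂ) (specialUnitaryUnits (Fin N)) x).Reg335 c35Y α₀ U →
        (bg9Y (Matrix (Fin N) (Fin N) ℂ) (specialUnitaryUnits (Fin N)) x).Reg336 c35Y α₀ U →
          CurrentMaj (𝔬12 x).blkW (𝔬12 x).blk
            (BcoKH x.toKIdx (trBasis N) (bg9Y (Matrix (Fin N) (Fin N) ℂ) (specialUnitaryUnits (Fin N)) x) (fun U => U) U)
            (BdcoKH x.toKIdx (trBasis N) (bg9Y (Matrix (Fin N) (Fin N) ℂ) (specialUnitaryUnits (Fin N)) x) (fun U => U) U) 1 (H x)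
            (tJ * ((geo9Y x).M * α₀)) δB := by
  intro x hM α₀ hα ha U hU hU'
  have hC1 : cJ * ((geo9Y x).M * α₀) ≤ 1 := (mul_le_mul_of_nonneg_left ha hcJ).trans ha1
  exact currentMaj_at_pins H x (𝔬12 x) (bI x) (hbI0 x) (hβ1 x) (hblk12 x) (hblkW12 x) hk₃ hcJ hα hC1 hδB htJ U
    (h3117g x hM α₀ hα ha U hU hU') (h3117d x hM α₀ hα ha U hU hU') (hreg x hM α₀ hα ha U hU hU')

/-- ★★ **THE STEP-3 (α) FACE: `hBJ` AT PRINT's CUBE CLASS FROM THE (3.117) CLAUSES ALONE** — objects over `bg9Y`, premises LITERALLY `(bg9YP …).Reg335 c α₀ U →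
(bg9YP …).Reg336 c α₀ U` (`c ≤ 10`; at the record `c := c35Y = 10`); the regularity at every fine bond is F12's THEOREM `regularAt_pinScale_of_regYP336` with the
constant `c_J := 10·L⁷` (so `10·L⁷·a ≤ 1`), and `t_J ≥ 2(d+1)·L³·k₃·(10⁴(d+1)·10L⁷)·e^{3δ_B}`.
[cite: Balaban1985BackgroundPropagators, (3.117) p.419, (3.35)–(3.36) p.396, p.422; Balaban1984PropagatorsII, (2.51) p.232, (2.2) p.224] -/
theorem hBJ_of_letters3117_P (H : MemberY θ.d₆ θ.ℓ₆ θ.hd' θ.hL' θ.b₀ θ.b₁ Mstar → Prop) (c : ℝ) (hc10 : c ≤ 10)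
    (𝔬12 : ∀ x : MemberY θ.d₆ θ.ℓ₆ θ.hd' θ.hL' θ.b₀ θ.b₁ Mstar, B9Thm312Whole.Ops (geo9Y x) (bg9Y (Matrix (Fin N) (Fin N) ℂ) (specialUnitaryUnits (Fin N)) x)
      (XBK (TrIdx N) x.toKIdx) (XBK (TrIdx N) x.toKIdx) (XHK (TrIdx N) x.toKIdx) (XSK (TrIdx N) x.toKIdx))
    (bI : ∀ x : MemberY θ.d₆ θ.ℓ₆ θ.hd' θ.hL' θ.b₀ θ.b₁ Mstar, FBondY x.toKIdx → IBondY x.toKIdx)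
    (hbI0 : ∀ (x : MemberY θ.d₆ θ.ℓ₆ θ.hd' θ.hL' θ.b₀ θ.b₁ Mstar) (f : FBondY x.toKIdx), bI x f = bI x ⟨f.src, 0⟩)
    (hβ1 : ∀ (x : MemberY θ.d₆ θ.ℓ₆ θ.hd' θ.hL' θ.b₀ θ.b₁ Mstar) (f : FBondY x.toKIdx), (geomT x.D).dist (β x.hN x.D x.hk (bI x f)) (blkV1 x.hN x.D f) ≤ 1)
    (hblk12 : ∀ x : MemberY θ.d₆ θ.ℓ₆ θ.hd' θ.hL' θ.b₀ θ.b₁ Mstar, (𝔬12 x).blk = blkBK x.toKIdx (bI x))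
    (hblkW12 : ∀ x : MemberY θ.d₆ θ.ℓ₆ θ.hd' θ.hL' θ.b₀ θ.b₁ Mstar, (𝔬12 x).blkW = blkSK x.toKIdx (sIK x.toKIdx (bI x)))
    (k₃ tJ δB M a : ℝ) (hk₃ : 0 ≤ k₃) (ha1 : 10 * ((θ.ℓ₆ + 1 : ℕ) : ℝ) ^ 7 * a ≤ 1) (hδB : 0 ≤ δB)
    (htJ : 2 * ((θ.d₆ : ℝ) + 1) * (((θ.ℓ₆ + 1 : ℕ) : ℝ)) ^ 3 * k₃ * (10 ^ 4 * ((θ.d₆ : ℝ) + 1) * (10 * ((θ.ℓ₆ + 1 : ℕ) : ℝ) ^ 7)) * Real.exp (3 * δB) ≤ tJ)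
    (h3117g : ∀ x : MemberY θ.d₆ θ.ℓ₆ θ.hd' θ.hL' θ.b₀ θ.b₁ Mstar, M ≤ (geo9Y x).M → ∀ α₀ : ℝ, 0 < α₀ → (geo9Y x).M * α₀ ≤ a →
      ∀ U : (bg9Y (Matrix (Fin N) (Fin N) ℂ) (specialUnitaryUnits (Fin N)) x).Cfg,
        (bg9YP (Matrix (Fin N) (Fin N) ℂ) (specialUnitaryUnits (Fin N)) x).Reg335 c α₀ U →
        (bg9YP (Matrix (Fin N) (Fin N) ℂ) (specialUnitaryUnits (Fin N)) x).Reg336 c α₀ U →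
          ∀ (Λ : SiteY x.toKIdx → Matrix (Fin N) (Fin N) ℂ) (f : FBondY x.toKIdx),
            ‖hessGradY x.toKIdx U Λ f‖ ≤ k₃ * ‖JY x.toKIdx U f‖ * (‖Λ (boxEquiv x.hN f.src)‖ + ‖Λ (boxEquiv x.hN f.tgt)‖))
    (h3117d : ∀ x : MemberY θ.d₆ θ.ℓ₆ θ.hd' θ.hL' θ.b₀ θ.b₁ Mstar, M ≤ (geo9Y x).M → ∀ α₀ : ℝ, 0 < α₀ → (geo9Y x).M * α₀ ≤ a →
      ∀ U : (bg9Y (Matrix (Fin N) (Fin N) ℂ) (specialUnitaryUnits (Fin N)) x).Cfg,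
        (bg9YP (Matrix (Fin N) (Fin N) ℂ) (specialUnitaryUnits (Fin N)) x).Reg335 c α₀ U →
        (bg9YP (Matrix (Fin N) (Fin N) ℂ) (specialUnitaryUnits (Fin N)) x).Reg336 c α₀ U →
          ∀ (A : FBondY x.toKIdx → Matrix (Fin N) (Fin N) ℂ) (s : Site (PV θ.d₆ θ.ℓ₆ x.toKIdx.m x.toKIdx.K θ.hd' θ.hL') 0),
            ‖divHessY x.toKIdx U A (boxEquiv x.hN s)‖ ≤ k₃ * ∑ μ : Fin (θ.d₆ + 1),
              (‖JY x.toKIdx U ⟨s, μ⟩‖ * ‖A ⟨s, μ⟩‖ + ‖JY x.toKIdx U ⟨s.unshift μ, μ⟩‖ * ‖A ⟨s.unshift μ, μ⟩‖)) :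
    ∀ x : MemberY θ.d₆ θ.ℓ₆ θ.hd' θ.hL' θ.b₀ θ.b₁ Mstar, M ≤ (geo9Y x).M → ∀ α₀ : ℝ, 0 < α₀ → (geo9Y x).M * α₀ ≤ a →
      ∀ U : (bg9Y (Matrix (Fin N) (Fin N) ℂ) (specialUnitaryUnits (Fin N)) x).Cfg,
        (bg9YP (Matrix (Fin N) (Fin N) ℂ) (specialUnitaryUnits (Fin N)) x).Reg335 c α₀ U →
        (bg9YP (Matrix (Fin N) (Fin N) ℂ) (specialUnitaryUnits (Fin N)) x).Reg336 c α₀ U →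
          CurrentMaj (𝔬12 x).blkW (𝔬12 x).blk
            (BcoKH x.toKIdx (trBasis N) (bg9Y (Matrix (Fin N) (Fin N) ℂ) (specialUnitaryUnits (Fin N)) x) (fun U => U) U)
            (BdcoKH x.toKIdx (trBasis N) (bg9Y (Matrix (Fin N) (Fin N) ℂ) (specialUnitaryUnits (Fin N)) x) (fun U => U) U) 1 (H x)
            (tJ * ((geo9Y x).M * α₀)) δB := by
  intro x hM α₀ hα ha U hU hU'
  have hcJ : (0 : ℝ) ≤ 10 * ((θ.ℓ₆ + 1 : ℕ) : ℝ) ^ 7 := by positivity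
  have hC1 : 10 * ((θ.ℓ₆ + 1 : ℕ) : ℝ) ^ 7 * ((geo9Y x).M * α₀) ≤ 1 := (mul_le_mul_of_nonneg_left ha hcJ).trans ha1
  refine currentMaj_at_pins H x (𝔬12 x) (bI x) (hbI0 x) (hβ1 x) (hblk12 x) (hblkW12 x) hk₃ hcJ hα hC1 hδB htJ U
    (h3117g x hM α₀ hα ha U hU hU') (h3117d x hM α₀ hα ha U hU hU') (fun μ s => ?_)
  exact regularAt_pinScale_of_regYP336 x hc10 hα.le hU' (bI x) (hβ1 x) μ ⟨s, 0⟩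

end Summit.QuantumFields.YangMills.BalabanUVNodes.N06CurrentMajAtPinsPhys

end
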